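import Summits.AtomisticToContinuum.Crystallization.Theorems.FrustratedLawDichotomyGSCSelfConsistentDoorBlind
import Summits.AtomisticToContinuum.Crystallization.Theorems.FrustratedLawDichotomyHardCoreUpgrade
import Summits.AtomisticToContinuum.Crystallization.Theorems.FrustratedLawDichotomyTextureAllBad

/-!
# FrustratedLawDichotomy · crux `AperiodicFrustratedLawGap` (stmt-AtomisticToContinuum-27623) — THE LOCAL-CLOSE-ORDER DOOR:
# the law-free residual follows from ONE positive statement about exact μ-equilibria of Lennard-Jones,
# «EVERY EXACT μ-EQUILIBRIUM HAS A CLOSE-PACKED SITE» (decomp-a2c, prover hand 2, structural share, generation 7)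

Generations 5–6 left the open core of the crux as the law-free residual `R_GSC` / `R_GSC^aper` (no rooted hard-core TEXTURED NASH configuration
is an `e⋆`-μGSC of `V_LJ`; `FrustratedLawDichotomyAperiodicGapGSCDoor`), exactly equivalent to its `e⋆`-free van Hove form `R_selfVH`
(`FrustratedLawDichotomyGSCSelfConsistentDoorBlind`).  Those residuals still carry the crux's five texture clauses, the Nash clause and (for the
aperiodic half) the aperiodicity clause as HYPOTHESES on the hypothetical configuration.  Of these, exactly one is load-bearing for a
contradiction with local crystalline order: clause (2) «every site is `1/20`-bad», which hand-1's texture transfer reads on the configuration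
itself as «NO ROBUSTLY GOOD ATOM» (`FrustratedLawDichotomyTextureAllBad.not_robustGood_of_texture`: no atom whose punctured `13/10·d`-shell,
`d` its nearest-neighbour distance, is within `η·d`, `η < 1/20`, of a rotated fcc or hcp kissing pattern, with a clean gap `γ > 0` at the
shell sphere).  Hence the residual — and with `MuEquilibriumDoor` (item 27073) the crux, its sibling, its registered stub and its
`PeriodicChargeSplit` copy, BY NAME — follows from the single, probability-free, texture-free POSITIVE statement

* `LCO` («LOCAL CLOSE ORDER SOMEWHERE»): every rooted `7/10`-separated set `X ⊆ ℝ³` which is an `e⋆`-μ-ground-state configuration of `V_LJ`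
  (`IsMuGSC lennardJones e⋆ X`, Sütő) has a ROBUSTLY GOOD atom (fcc or hcp);

equivalently (`localCloseOrder_iff_localCloseOrderVH`, by the zero-pressure chemical-potential theorem of generation 6) from its `e⋆`-FREE form

* `LCO_VH`: every rooted `7/10`-separated `X ⊆ ℝ³` which is a `μc`-GSC of `V_LJ` at the energy density `μc` of its own root-centred van Hove
  balls has a robustly good atom.

`LCO` is the configuration-level «crystallization somewhere» statement: an exact infinite-volume μ-equilibrium of Lennard-Jones cannot be
everywhere frustrated — it is STRONGER than the residual (it also covers the TCP-bulk / coarse-majority / holed textures that clauses (3)–(5) hand to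
sibling cruxes, and non-Nash or periodic configurations), and it is consistent with every configuration believed to be an exact
μ-equilibrium (Barlow stackings and their half-spaces and flat twins all have close-packed sites).  The nominal hard core `δ` of the residual is
idle (`isRootedHardCore_upgrade`: textured configurations are `7/10`-separated), so `LCO` is stated at separation `7/10` only.

Theorems: `rGSC_of_localCloseOrder` (`LCO → R_GSC`), `localCloseOrder_iff_localCloseOrderVH`, `rSelfVH_of_localCloseOrderVH`
(`LCO_VH → R_selfVH`), and BY NAME `aperiodicFrustratedLawGap_of_localCloseOrder`, `periodicFrustratedLawGap_of_localCloseOrder`,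
`aperiodicErgodicGap_of_localCloseOrder` (registered stub `stub_aperiodicErgodicGap` of skeleton dd3251ad, text verbatim),
`periodicChargeSplit_aperiodicFrustratedLawGap_of_localCloseOrder`.  All `[folklore]` bookkeeping; no literature content.
-/

noncomputable section

namespace Summit.AtomisticToContinuum.Crystallization.Theorems.FrustratedLawDichotomyLocalCloseOrder

open MeasureTheory Filter Topology
open Literature.MathematicalPhysics.StatisticalMechanics
open Literature.Probability.Process (IsRootedHardCore count_restrict_singleton_ne_zero_iff)
open Summit.AtomisticToContinuum.Crystallization.Theorems.ChargedEnergyGapNegative (E3 eStar)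
open Summit.AtomisticToContinuum.Crystallization.Theorems.FrustratedLawDichotomyGSCVanHoveBalls (exists_balls_energyPerAtom_tendsto_eStar)
open Summit.AtomisticToContinuum.Crystallization.Theorems.FrustratedLawDichotomyGSCChemicalPotential (mu_eq_eStar_of_vanHove_density)
open Summit.AtomisticToContinuum.Crystallization.Theorems.FrustratedLawDichotomyGSCDoor
  (rGSCaper_of_rGSC aperiodicFrustratedLawGap_of_muEquilibriumDoor periodicFrustratedLawGap_of_muEquilibriumDoor
    aperiodicErgodicGap_of_muEquilibriumDoor periodicChargeSplit_aperiodicFrustratedLawGap_of_muEquilibriumDoor)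
open Summit.AtomisticToContinuum.Crystallization.Theorems.FrustratedLawDichotomyGSCSelfConsistentDoorExact (tendsto_of_quarter_le)
open Summit.AtomisticToContinuum.Crystallization.Theorems.FrustratedLawDichotomyGSCSelfConsistentDoorBlind (rGSC_iff_selfConsistentVH_blind)
open Summit.AtomisticToContinuum.Crystallization.Theorems.FrustratedLawDichotomyHardCoreUpgrade (isRootedHardCore_upgrade)
open Summit.AtomisticToContinuum.Crystallization.Theorems.FrustratedLawDichotomyTextureAllBad (not_robustGood_of_texture)

/-- **THE LOCAL-CLOSE-ORDER DOOR**: `LCO → R_GSC`.  If every rooted `7/10`-separated `e⋆`-μGSC of `V_LJ` has a robustly good atom, then no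
rooted hard-core textured Nash configuration is an `e⋆`-μGSC (the periodicity-blind law-free residual of generation 5, text verbatim).  Proof:
texture makes the configuration `7/10`-separated (`isRootedHardCore_upgrade`) and kills every robustly good atom
(`not_robustGood_of_texture`); `LCO` supplies one. [folklore] -/
theorem rGSC_of_localCloseOrder
    (hLCO : ∀ X : Set (EuclideanSpace ℝ (Fin 3)), (0 : EuclideanSpace ℝ (Fin 3)) ∈ X → (∀ a ∈ X, ∀ b ∈ X, a ≠ b → (7 : ℝ) / 10 ≤ dist a b) → Literature.MathematicalPhysics.StatisticalMechanics.IsMuGSC Literature.MathematicalPhysics.StatisticalMechanics.lennardJones (⨅ Q : Literature.MathematicalPhysics.StatisticalMechanics.PeriodicConfiguration 3, Q.energyPerParticle Literature.MathematicalPhysics.StatisticalMechanics.lennardJones) X → ∃ p : EuclideanSpace ℝ (Fin 3), p ∈ X ∧ ∃ (d η γ : ℝ) (A : EuclideanSpace ℝ (Fin 3) →ₗᵢ[ℝ] EuclideanSpace ℝ (Fin 3)), (∃ t : ↥Literature.Geometry.DiscreteGeometry.fccKissingPattern → EuclideanSpace ℝ (Fin 3), 0 < d ∧ 0 < γ ∧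 η < 1 / 20 ∧ (∀ u : ↥Literature.Geometry.DiscreteGeometry.fccKissingPattern, t u ∈ X ∧ ‖(t u - p) - d • A (u : EuclideanSpace ℝ (Fin 3))‖ ≤ η * d) ∧ (∀ s : EuclideanSpace ℝ (Fin 3), s ∈ X → s ≠ p → d ≤ dist s p) ∧ (∃ s : EuclideanSpace ℝ (Fin 3), s ∈ X ∧ s ≠ p ∧ dist s p ≤ d) ∧ (∀ s : EuclideanSpace ℝ (Fin 3), s ∈ X → s ≠ p → dist s p < 13 / 10 * d + γ → dist s p ≤ 13 / 10 * d - γ ∧ s ∈ Set.range t)) ∨ (∃ t : ↥Literature.Geometry.DiscreteGeometry.hcpKissingPattern → EuclideanSpace ℝ (Fin 3), 0 < d ∧ 0 < γ ∧ η < 1 / 20 ∧ (∀ u : ↥Literature.Geometry.DiscreteGeometry.hcpKissingPattern, t u ∈ X ∧ ‖(t u - p) - d • A (u : EuclideanSpace ℝ (Fin 3))‖ ≤ η * d) ∧ (∀ s : EuclideanSpace ℝ (Fin 3), s ∈ X → s ≠ p → d ≤ dist s p) ∧ (∃ s : EuclideanSpace ℝ (Fin 3), s ∈ X ∧ s ≠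 p ∧ dist s p ≤ d) ∧ (∀ s : EuclideanSpace ℝ (Fin 3), s ∈ X → s ≠ p → dist s p < 13 / 10 * d + γ → dist s p ≤ 13 / 10 * d - γ ∧ s ∈ Set.range t))) :
    ∀ δ : ℝ, 0 < δ → ∀ R₇ R₈ R₉ : ℝ, ∀ μ : MeasureTheory.Measure (EuclideanSpace ℝ (Fin 3)), let Gy : ℝ → (N : ℕ) → (Fin N → EuclideanSpace ℝ (Fin 3)) → Fin N → Prop := fun η N y j => let d : ℝ := sInf ((fun z => dist z (y (j : Fin N))) '' (Set.range (y) \ {(y (j : Fin N))})); let T : Set (EuclideanSpace ℝ (Fin 3)) := {z : EuclideanSpace ℝ (Fin 3) | z ∈ Set.range (y) ∧ z ≠ (y (j : Fin N)) ∧ dist z (y (j : Fin N)) < 13 / 10 * d}; ∃ A : EuclideanSpace ℝ (Fin 3) →ₗᵢ[ℝ] EuclideanSpace ℝ (Fin 3), (∃ e : ↥T ≃ ↥Literature.Geometry.DiscreteGeometry.fccKissingPattern, ∀ t : ↥T, dist (d⁻¹ • ((t : EuclideanSpace ℝ (Fin 3)) - (y (j : Fin N)))) (A ((e t : ↥Literature.Geometry.DiscreteGeometry.fccKissingPattern)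 : EuclideanSpace ℝ (Fin 3))) ≤ η) ∨ (∃ e : ↥T ≃ ↥Literature.Geometry.DiscreteGeometry.hcpKissingPattern, ∀ t : ↥T, dist (d⁻¹ • ((t : EuclideanSpace ℝ (Fin 3)) - (y (j : Fin N)))) (A ((e t : ↥Literature.Geometry.DiscreteGeometry.hcpKissingPattern) : EuclideanSpace ℝ (Fin 3))) ≤ η); let TexBall : (N : ℕ) → (Fin N → EuclideanSpace ℝ (Fin 3)) → Fin N → ℝ → ℝ → ℝ → ℝ → Prop := fun N y i R R₇ R₈ R₉ => (∀ a b : Fin N, a ≠ b → (7 : ℝ) / 10 ≤ dist (y a) (y b)) ∧ (∀ j : Fin N, dist (y j) (y i) ≤ R → ¬ Gy (1 / 20) N (y) j) ∧ (∀ j : Fin N, dist (y j) (y i) ≤ R → ¬ ((∀ j' : Fin N, dist (y j') (y j) ≤ R₇ → ¬ Gy (1 / 20) N (y) j') ∧ (∀ z : EuclideanSpace ℝ (Fin 3), dist z (y j) ≤ R₇ → ∃ k : Fin N, dist z (y k) ≤ 1) ∧ (∀ j' : Fin N, dist (y j') (y j) ≤ R₇ → (let d : ℝ := sInf ((fun z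 => dist z (y j')) '' (Set.range (y) \ {(y j')})); ∀ k : Fin N, y k ≠ y j' → dist (y k) (y j') < 27 / 20 * d → 5 ≤ Nat.card {m : Fin N // y m ≠ y j' ∧ dist (y m) (y j') < 27 / 20 * d ∧ y m ≠ y k ∧ dist (y m) (y k) < 27 / 20 * d})))) ∧ (∀ j : Fin N, dist (y j) (y i) ≤ R → ∃ k : Fin N, dist (y k) (y j) ≤ R₈ ∧ Gy (1 / 8) N (y) k) ∧ (∀ j : Fin N, dist (y j) (y i) ≤ R → ¬ ((∀ j' : Fin N, dist (y j') (y j) ≤ R₉ → ¬ Gy (1 / 20) N (y) j') ∧ (Nat.card {j' : Fin N // dist (y j') (y j) ≤ R₉ ∧ ¬ Gy (1 / 8) N (y) j'} : ℝ) ≤ 1 / 2 * (Nat.card {j' : Fin N // dist (y j') (y j) ≤ R₉} : ℝ) ∧ (∀ j' : Fin N, dist (y j') (y j) ≤ R₉ → ¬ Gy (1 / 8) N (y) j' → ¬ (let d : ℝ := sInf ((fun z => dist z (y j')) '' (Set.range (y) \ {(y j')})); ∀ k : Fin N, y k ≠ y j' → dist (y k) (y j') < 27 / 20 * d → 5 ≤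 Nat.card {m : Fin N // y m ≠ y j' ∧ dist (y m) (y j') < 27 / 20 * d ∧ y m ≠ y k ∧ dist (y m) (y k) < 27 / 20 * d})))); let Appr : MeasureTheory.Measure (EuclideanSpace ℝ (Fin 3)) → ℝ → ℝ → ℝ → Prop := fun μ R₇ R₈ R₉ => ∀ q : EuclideanSpace ℝ (Fin 3), μ {q} ≠ 0 → ∀ R ε : ℝ, 0 < ε → ∃ (N : ℕ) (y : Fin N → EuclideanSpace ℝ (Fin 3)) (i : Fin N), TexBall N y i R R₇ R₈ R₉ ∧ (∀ p : EuclideanSpace ℝ (Fin 3), μ {p} ≠ 0 → dist p q ≤ R → ∃ k : Fin N, dist (y k - y i) (p - q) ≤ ε) ∧ (∀ k : Fin N, dist (y k) (y i) ≤ R → ∃ p : EuclideanSpace ℝ (Fin 3), μ {p} ≠ 0 ∧ dist (y k - y i) (p - q) ≤ ε); Literature.Probability.Process.IsRootedHardCore δ μ → Appr μ R₇ R₈ R₉ → (∀ p : EuclideanSpace ℝ (Fin 3), μ {p} ≠ 0 → ∀ y : EuclideanSpace ℝ (Fin 3), (∀ q : EuclideanSpace ℝ (Fin 3), μ {q} ≠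 0 → q ≠ p → y ≠ q) → ∑' q : {q : EuclideanSpace ℝ (Fin 3) // μ {q} ≠ 0 ∧ q ≠ p}, Literature.MathematicalPhysics.StatisticalMechanics.lennardJones (dist p (q : EuclideanSpace ℝ (Fin 3))) ≤ ∑' q : {q : EuclideanSpace ℝ (Fin 3) // μ {q} ≠ 0 ∧ q ≠ p}, Literature.MathematicalPhysics.StatisticalMechanics.lennardJones (dist y (q : EuclideanSpace ℝ (Fin 3)))) → ¬ Literature.MathematicalPhysics.StatisticalMechanics.IsMuGSC Literature.MathematicalPhysics.StatisticalMechanics.lennardJones (⨅ Q : Literature.MathematicalPhysics.StatisticalMechanics.PeriodicConfiguration 3, Q.energyPerParticle Literature.MathematicalPhysics.StatisticalMechanics.lennardJones) {p : EuclideanSpace ℝ (Fin 3) | μ {p} ≠ 0} := by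
  intro δ hδ R₇ R₈ R₉ μ
  dsimp only
  intro hcore happr hnash hGSC
  have hcore7 : IsRootedHardCore (7 / 10) μ :=
    isRootedHardCore_upgrade hcore fun q hq R ε hε => by
      obtain ⟨N, y, i, hT, hm, -⟩ := happr q hq R ε hε
      exact ⟨N, y, i, hT.1, hm⟩
  obtain ⟨S, h0S, hsepS, hμS⟩ := hcore7
  have hat : ∀ p : EuclideanSpace ℝ (Fin 3), μ {p} ≠ 0 ↔ p ∈ S := fun p => by
    rw [hμS]; exact count_restrict_singleton_ne_zero_iff S p
  have hXS : {p : EuclideanSpace ℝ (Fin 3) | μ {p} ≠ 0} = S := Set.ext hat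
  rw [hXS] at hGSC
  obtain ⟨p, hpS, d, η, γ, A, hgood⟩ := hLCO S h0S hsepS hGSC
  have hbad := not_robustGood_of_texture hδ hcore (fun q hq R ε hε => by
      obtain ⟨N, y, i, ⟨hsep, h2, -, -, -⟩, hm1, hm2⟩ := happr q hq R ε hε
      exact ⟨N, y, i, hsep, h2, hm1, hm2⟩) ((hat p).2 hpS) d η γ A
  rcases hgood with ⟨t, hd, hγ, hη, ht, hnn₁, hnn₂, hgap⟩ | ⟨t, hd, hγ, hη, ht, hnn₁, hnn₂, hgap⟩
  · obtain ⟨s, hs, hsp, hsd⟩ := hnn₂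
    exact hbad.1 t ⟨hd, hγ, hη, fun u => ⟨(hat _).2 (ht u).1, (ht u).2⟩, fun s hs => hnn₁ s ((hat s).1 hs),
      ⟨s, (hat s).2 hs, hsp, hsd⟩, fun s hs => hgap s ((hat s).1 hs)⟩
  · obtain ⟨s, hs, hsp, hsd⟩ := hnn₂
    exact hbad.2 t ⟨hd, hγ, hη, fun u => ⟨(hat _).2 (ht u).1, (ht u).2⟩, fun s hs => hnn₁ s ((hat s).1 hs),
      ⟨s, (hat s).2 hs, hsp, hsd⟩, fun s hs => hgap s ((hat s).1 hs)⟩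

/-- **`LCO ⟺ LCO_VH`: the `e⋆`-free form of the local-close-order statement.**  A rooted separated `μc`-GSC of `V_LJ` whose root-centred van
Hove balls have energy density `μc` has `μc = e⋆` (`mu_eq_eStar_of_vanHove_density`); conversely every rooted separated `e⋆`-μGSC carries such
balls with `μc = e⋆` (`exists_balls_energyPerAtom_tendsto_eStar`). [folklore] -/
theorem localCloseOrder_iff_localCloseOrderVH :
    (∀ X : Set (EuclideanSpace ℝ (Fin 3)), (0 : EuclideanSpace ℝ (Fin 3)) ∈ X → (∀ a ∈ X, ∀ b ∈ X, a ≠ b → (7 : ℝ) / 10 ≤ dist a b) → Literature.MathematicalPhysics.StatisticalMechanics.IsMuGSC Literature.MathematicalPhysics.StatisticalMechanics.lennardJones (⨅ Q : Literature.MathematicalPhysics.StatisticalMechanics.PeriodicConfiguration 3, Q.energyPerParticle Literature.MathematicalPhysics.StatisticalMechanics.lennardJones) X → ∃ p : EuclideanSpace ℝ (Fin 3), p ∈ X ∧ ∃ (d η γ : ℝ) (A : EuclideanSpace ℝ (Fin 3) →ₗᵢ[ℝ] EuclideanSpace ℝ (Fin 3)), (∃ t : ↥Literature.Geometry.DiscreteGeometry.fccKissingPattern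 → EuclideanSpace ℝ (Fin 3), 0 < d ∧ 0 < γ ∧ η < 1 / 20 ∧ (∀ u : ↥Literature.Geometry.DiscreteGeometry.fccKissingPattern, t u ∈ X ∧ ‖(t u - p) - d • A (u : EuclideanSpace ℝ (Fin 3))‖ ≤ η * d) ∧ (∀ s : EuclideanSpace ℝ (Fin 3), s ∈ X → s ≠ p → d ≤ dist s p) ∧ (∃ s : EuclideanSpace ℝ (Fin 3), s ∈ X ∧ s ≠ p ∧ dist s p ≤ d) ∧ (∀ s : EuclideanSpace ℝ (Fin 3), s ∈ X → s ≠ p → dist s p < 13 / 10 * d + γ → dist s p ≤ 13 / 10 * d - γ ∧ s ∈ Set.range t)) ∨ (∃ t : ↥Literature.Geometry.DiscreteGeometry.hcpKissingPattern → EuclideanSpace ℝ (Fin 3), 0 < d ∧ 0 < γ ∧ η < 1 / 20 ∧ (∀ u : ↥Literature.Geometry.DiscreteGeometry.hcpKissingPattern, t u ∈ X ∧ ‖(t u - p) - d • A (u : EuclideanSpace ℝ (Fin 3))‖ ≤ η * d) ∧ (∀ s : EuclideanSpace ℝ (Fin 3), s ∈ X → s ≠ p → d ≤ dist s p) ∧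 (∃ s : EuclideanSpace ℝ (Fin 3), s ∈ X ∧ s ≠ p ∧ dist s p ≤ d) ∧ (∀ s : EuclideanSpace ℝ (Fin 3), s ∈ X → s ≠ p → dist s p < 13 / 10 * d + γ → dist s p ≤ 13 / 10 * d - γ ∧ s ∈ Set.range t))) ↔
    (∀ X : Set (EuclideanSpace ℝ (Fin 3)), (0 : EuclideanSpace ℝ (Fin 3)) ∈ X → (∀ a ∈ X, ∀ b ∈ X, a ≠ b → (7 : ℝ) / 10 ≤ dist a b) → ∀ μc : ℝ, (∃ (r : ℕ → ℝ) (n : ℕ → ℕ) (xf : ∀ j : ℕ, Fin (n j) → EuclideanSpace ℝ (Fin 3)), (∀ j : ℕ, (j : ℝ) / 4 ≤ r j) ∧ (∀ j, Function.Injective (xf j)) ∧ (∀ j, Set.range (xf j) = X ∩ Metric.closedBall 0 (r j)) ∧ (∀ j, 0 < n j) ∧ Filter.Tendsto (fun j => Literature.MathematicalPhysics.StatisticalMechanics.interactionEnergy Literature.MathematicalPhysics.StatisticalMechanics.lennardJones (xf j) / (n j : ℝ)) Filter.atTop (nhds μc) ∧ Filter.Tendsto (fun j => (∑ i, ∑'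 y : ↥(X \ Set.range (xf j)), Literature.MathematicalPhysics.StatisticalMechanics.lennardJones (dist (xf j i) y)) / (n j : ℝ)) Filter.atTop (nhds 0)) → Literature.MathematicalPhysics.StatisticalMechanics.IsMuGSC Literature.MathematicalPhysics.StatisticalMechanics.lennardJones μc X → ∃ p : EuclideanSpace ℝ (Fin 3), p ∈ X ∧ ∃ (d η γ : ℝ) (A : EuclideanSpace ℝ (Fin 3) →ₗᵢ[ℝ] EuclideanSpace ℝ (Fin 3)), (∃ t : ↥Literature.Geometry.DiscreteGeometry.fccKissingPattern → EuclideanSpace ℝ (Fin 3), 0 < d ∧ 0 < γ ∧ η < 1 / 20 ∧ (∀ u : ↥Literature.Geometry.DiscreteGeometry.fccKissingPattern, t u ∈ X ∧ ‖(t u - p) - d • A (u : EuclideanSpace ℝ (Fin 3))‖ ≤ η * d) ∧ (∀ s : EuclideanSpace ℝ (Fin 3), s ∈ X → s ≠ p → d ≤ dist s p) ∧ (∃ s : EuclideanSpace ℝ (Fin 3), s ∈ X ∧ s ≠ p ∧ dist s p ≤ d) ∧ (∀ s : EuclideanSpace ℝ (Fin 3), s ∈ X → s ≠ p → dist s p <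 13 / 10 * d + γ → dist s p ≤ 13 / 10 * d - γ ∧ s ∈ Set.range t)) ∨ (∃ t : ↥Literature.Geometry.DiscreteGeometry.hcpKissingPattern → EuclideanSpace ℝ (Fin 3), 0 < d ∧ 0 < γ ∧ η < 1 / 20 ∧ (∀ u : ↥Literature.Geometry.DiscreteGeometry.hcpKissingPattern, t u ∈ X ∧ ‖(t u - p) - d • A (u : EuclideanSpace ℝ (Fin 3))‖ ≤ η * d) ∧ (∀ s : EuclideanSpace ℝ (Fin 3), s ∈ X → s ≠ p → d ≤ dist s p) ∧ (∃ s : EuclideanSpace ℝ (Fin 3), s ∈ X ∧ s ≠ p ∧ dist s p ≤ d) ∧ (∀ s : EuclideanSpace ℝ (Fin 3), s ∈ X → s ≠ p → dist s p < 13 / 10 * d + γ → dist s p ≤ 13 / 10 * d - γ ∧ s ∈ Set.range t))) := by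
  constructor
  · intro hLCO X h0 hsep μc hballs hGSC
    obtain ⟨r, n, xf, hr, hinj, hrange, hnpos, hU, hI⟩ := hballs
    have hμc : μc = eStar :=
      mu_eq_eStar_of_vanHove_density (by norm_num : (0 : ℝ) < 7 / 10) hsep hGSC hinj hrange hnpos (tendsto_of_quarter_le hr) hI hU
    rw [hμc] at hGSC
    exact hLCO X h0 hsep hGSC
  · intro hVH X h0 hsep hGSC
    obtain ⟨r, n, xf, hr, hinj, hrange, hnpos, hI, hU⟩ :=
      exists_balls_energyPerAtom_tendsto_eStar (by norm_num : (0 : ℝ) < 7 / 10) hsep h0 hGSC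
    exact hVH X h0 hsep _ ⟨r, n, xf, hr, hinj, hrange, hnpos, hU, hI⟩ hGSC

/-- **`LCO_VH → R_selfVH`**: the `e⋆`-free local-close-order statement implies the `e⋆`-free residual of record (blind van Hove form, text
verbatim). [folklore] -/
theorem rSelfVH_of_localCloseOrderVH
    (hVH : ∀ X : Set (EuclideanSpace ℝ (Fin 3)), (0 : EuclideanSpace ℝ (Fin 3)) ∈ X → (∀ a ∈ X, ∀ b ∈ X, a ≠ b → (7 : ℝ) / 10 ≤ dist a b) → ∀ μc : ℝ, (∃ (r : ℕ → ℝ) (n : ℕ → ℕ) (xf : ∀ j : ℕ, Fin (n j) → EuclideanSpace ℝ (Fin 3)), (∀ j : ℕ, (j : ℝ) / 4 ≤ r j) ∧ (∀ j, Function.Injective (xf j)) ∧ (∀ j, Set.range (xf j) = X ∩ Metric.closedBall 0 (r j)) ∧ (∀ j, 0 < n j) ∧ Filter.Tendsto (fun j => Literature.MathematicalPhysics.StatisticalMechanics.interactionEnergy Literature.MathematicalPhysics.StatisticalMechanics.lennardJones (xf j) / (n j : ℝ)) Filter.atTop (nhds μc) ∧ Filter.Tendsto (fun j => (∑ i, ∑'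 y : ↥(X \ Set.range (xf j)), Literature.MathematicalPhysics.StatisticalMechanics.lennardJones (dist (xf j i) y)) / (n j : ℝ)) Filter.atTop (nhds 0)) → Literature.MathematicalPhysics.StatisticalMechanics.IsMuGSC Literature.MathematicalPhysics.StatisticalMechanics.lennardJones μc X → ∃ p : EuclideanSpace ℝ (Fin 3), p ∈ X ∧ ∃ (d η γ : ℝ) (A : EuclideanSpace ℝ (Fin 3) →ₗᵢ[ℝ] EuclideanSpace ℝ (Fin 3)), (∃ t : ↥Literature.Geometry.DiscreteGeometry.fccKissingPattern → EuclideanSpace ℝ (Fin 3), 0 < d ∧ 0 < γ ∧ η < 1 / 20 ∧ (∀ u : ↥Literature.Geometry.DiscreteGeometry.fccKissingPattern, t u ∈ X ∧ ‖(t u - p) - d • A (u : EuclideanSpace ℝ (Fin 3))‖ ≤ η * d) ∧ (∀ s : EuclideanSpace ℝ (Fin 3), s ∈ X → s ≠ p → d ≤ dist s p) ∧ (∃ s : EuclideanSpace ℝ (Fin 3), s ∈ X ∧ s ≠ p ∧ dist s p ≤ d) ∧ (∀ s : EuclideanSpace ℝ (Fin 3), s ∈ X → s ≠ p → dist s p <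 13 / 10 * d + γ → dist s p ≤ 13 / 10 * d - γ ∧ s ∈ Set.range t)) ∨ (∃ t : ↥Literature.Geometry.DiscreteGeometry.hcpKissingPattern → EuclideanSpace ℝ (Fin 3), 0 < d ∧ 0 < γ ∧ η < 1 / 20 ∧ (∀ u : ↥Literature.Geometry.DiscreteGeometry.hcpKissingPattern, t u ∈ X ∧ ‖(t u - p) - d • A (u : EuclideanSpace ℝ (Fin 3))‖ ≤ η * d) ∧ (∀ s : EuclideanSpace ℝ (Fin 3), s ∈ X → s ≠ p → d ≤ dist s p) ∧ (∃ s : EuclideanSpace ℝ (Fin 3), s ∈ X ∧ s ≠ p ∧ dist s p ≤ d) ∧ (∀ s : EuclideanSpace ℝ (Fin 3), s ∈ X → s ≠ p → dist s p < 13 / 10 * d + γ → dist s p ≤ 13 / 10 * d - γ ∧ s ∈ Set.range t))) :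
    ∀ δ : ℝ, 0 < δ → ∀ R₇ R₈ R₉ : ℝ, ∀ μ : MeasureTheory.Measure (EuclideanSpace ℝ (Fin 3)), let Gy : ℝ → (N : ℕ) → (Fin N → EuclideanSpace ℝ (Fin 3)) → Fin N → Prop := fun η N y j => let d : ℝ := sInf ((fun z => dist z (y (j : Fin N))) '' (Set.range (y) \ {(y (j : Fin N))})); let T : Set (EuclideanSpace ℝ (Fin 3)) := {z : EuclideanSpace ℝ (Fin 3) | z ∈ Set.range (y) ∧ z ≠ (y (j : Fin N)) ∧ dist z (y (j : Fin N)) < 13 / 10 * d}; ∃ A : EuclideanSpace ℝ (Fin 3) →ₗᵢ[ℝ] EuclideanSpace ℝ (Fin 3), (∃ e : ↥T ≃ ↥Literature.Geometry.DiscreteGeometry.fccKissingPattern, ∀ t : ↥T, dist (d⁻¹ • ((t : EuclideanSpace ℝ (Fin 3)) - (y (j : Fin N)))) (A ((e t : ↥Literature.Geometry.DiscreteGeometry.fccKissingPattern) : EuclideanSpace ℝ (Fin 3))) ≤ η) ∨ (∃ e : ↥T ≃ ↥Literature.Geometry.DiscreteGeometry.hcpKissingPattern, ∀ t : ↥T,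 dist (d⁻¹ • ((t : EuclideanSpace ℝ (Fin 3)) - (y (j : Fin N)))) (A ((e t : ↥Literature.Geometry.DiscreteGeometry.hcpKissingPattern) : EuclideanSpace ℝ (Fin 3))) ≤ η); let TexBall : (N : ℕ) → (Fin N → EuclideanSpace ℝ (Fin 3)) → Fin N → ℝ → ℝ → ℝ → ℝ → Prop := fun N y i R R₇ R₈ R₉ => (∀ a b : Fin N, a ≠ b → (7 : ℝ) / 10 ≤ dist (y a) (y b)) ∧ (∀ j : Fin N, dist (y j) (y i) ≤ R → ¬ Gy (1 / 20) N (y) j) ∧ (∀ j : Fin N, dist (y j) (y i) ≤ R → ¬ ((∀ j' : Fin N, dist (y j') (y j) ≤ R₇ → ¬ Gy (1 / 20) N (y) j') ∧ (∀ z : EuclideanSpace ℝ (Fin 3), dist z (y j) ≤ R₇ → ∃ k : Fin N, dist z (y k) ≤ 1) ∧ (∀ j' : Fin N, dist (y j') (y j) ≤ R₇ → (let d : ℝ := sInf ((fun z => dist z (y j')) '' (Set.range (y) \ {(y j')})); ∀ k : Fin N, y k ≠ y j' → dist (y k) (y j') < 27 / 20 * d → 5 ≤ Nat.card {m : Fin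 N // y m ≠ y j' ∧ dist (y m) (y j') < 27 / 20 * d ∧ y m ≠ y k ∧ dist (y m) (y k) < 27 / 20 * d})))) ∧ (∀ j : Fin N, dist (y j) (y i) ≤ R → ∃ k : Fin N, dist (y k) (y j) ≤ R₈ ∧ Gy (1 / 8) N (y) k) ∧ (∀ j : Fin N, dist (y j) (y i) ≤ R → ¬ ((∀ j' : Fin N, dist (y j') (y j) ≤ R₉ → ¬ Gy (1 / 20) N (y) j') ∧ (Nat.card {j' : Fin N // dist (y j') (y j) ≤ R₉ ∧ ¬ Gy (1 / 8) N (y) j'} : ℝ) ≤ 1 / 2 * (Nat.card {j' : Fin N // dist (y j') (y j) ≤ R₉} : ℝ) ∧ (∀ j' : Fin N, dist (y j') (y j) ≤ R₉ → ¬ Gy (1 / 8) N (y) j' → ¬ (let d : ℝ := sInf ((fun z => dist z (y j')) '' (Set.range (y) \ {(y j')})); ∀ k : Fin N, y k ≠ y j' → dist (y k) (y j') < 27 / 20 * d → 5 ≤ Nat.card {m : Fin N // y m ≠ y j' ∧ dist (y m) (y j') < 27 / 20 * d ∧ y m ≠ y k ∧ dist (y m) (y k) < 27 / 20 * d}))));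 let Appr : MeasureTheory.Measure (EuclideanSpace ℝ (Fin 3)) → ℝ → ℝ → ℝ → Prop := fun μ R₇ R₈ R₉ => ∀ q : EuclideanSpace ℝ (Fin 3), μ {q} ≠ 0 → ∀ R ε : ℝ, 0 < ε → ∃ (N : ℕ) (y : Fin N → EuclideanSpace ℝ (Fin 3)) (i : Fin N), TexBall N y i R R₇ R₈ R₉ ∧ (∀ p : EuclideanSpace ℝ (Fin 3), μ {p} ≠ 0 → dist p q ≤ R → ∃ k : Fin N, dist (y k - y i) (p - q) ≤ ε) ∧ (∀ k : Fin N, dist (y k) (y i) ≤ R → ∃ p : EuclideanSpace ℝ (Fin 3), μ {p} ≠ 0 ∧ dist (y k - y i) (p - q) ≤ ε); Literature.Probability.Process.IsRootedHardCore δ μ → Appr μ R₇ R₈ R₉ → (∀ p : EuclideanSpace ℝ (Fin 3), μ {p} ≠ 0 → ∀ y : EuclideanSpace ℝ (Fin 3), (∀ q : EuclideanSpace ℝ (Fin 3), μ {q} ≠ 0 → q ≠ p → y ≠ q) → ∑' q : {q : EuclideanSpace ℝ (Fin 3) // μ {q} ≠ 0 ∧ q ≠ p}, Literature.MathematicalPhysics.StatisticalMechanics.lennardJones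 (dist p (q : EuclideanSpace ℝ (Fin 3))) ≤ ∑' q : {q : EuclideanSpace ℝ (Fin 3) // μ {q} ≠ 0 ∧ q ≠ p}, Literature.MathematicalPhysics.StatisticalMechanics.lennardJones (dist y (q : EuclideanSpace ℝ (Fin 3)))) → ∀ μc : ℝ, (∃ (r : ℕ → ℝ) (n : ℕ → ℕ) (xf : ∀ j : ℕ, Fin (n j) → EuclideanSpace ℝ (Fin 3)), (∀ j : ℕ, (j : ℝ) / 4 ≤ r j) ∧ (∀ j, Function.Injective (xf j)) ∧ (∀ j, Set.range (xf j) = {p : EuclideanSpace ℝ (Fin 3) | μ {p} ≠ 0} ∩ Metric.closedBall 0 (r j)) ∧ (∀ j, 0 < n j) ∧ Filter.Tendsto (fun j => Literature.MathematicalPhysics.StatisticalMechanics.interactionEnergy Literature.MathematicalPhysics.StatisticalMechanics.lennardJones (xf j) / (n j : ℝ)) Filter.atTop (nhds μc) ∧ Filter.Tendsto (fun j => (∑ i, ∑' y : ↥({p : EuclideanSpace ℝ (Fin 3) | μ {p} ≠ 0} \ Set.range (xf j)), Literature.MathematicalPhysics.StatisticalMechanics.lennardJones (dist (xf j i) y))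 / (n j : ℝ)) Filter.atTop (nhds 0)) → ¬ Literature.MathematicalPhysics.StatisticalMechanics.IsMuGSC Literature.MathematicalPhysics.StatisticalMechanics.lennardJones μc {p : EuclideanSpace ℝ (Fin 3) | μ {p} ≠ 0} :=
  rGSC_iff_selfConsistentVH_blind.1 (rGSC_of_localCloseOrder (localCloseOrder_iff_localCloseOrderVH.2 hVH))

/-- **`AperiodicFrustratedLawGap` (crux of item 27623) BY NAME from `LCO`**, granted `MuEquilibriumDoor` (item 27073). [folklore] -/
theorem aperiodicFrustratedLawGap_of_localCloseOrder
    (hDoor : Summit.AtomisticToContinuum.Crystallization.Theses.GrainCoreNetworkSplit.MuEquilibriumDoor)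
    (hLCO : ∀ X : Set (EuclideanSpace ℝ (Fin 3)), (0 : EuclideanSpace ℝ (Fin 3)) ∈ X → (∀ a ∈ X, ∀ b ∈ X, a ≠ b → (7 : ℝ) / 10 ≤ dist a b) → Literature.MathematicalPhysics.StatisticalMechanics.IsMuGSC Literature.MathematicalPhysics.StatisticalMechanics.lennardJones (⨅ Q : Literature.MathematicalPhysics.StatisticalMechanics.PeriodicConfiguration 3, Q.energyPerParticle Literature.MathematicalPhysics.StatisticalMechanics.lennardJones) X → ∃ p : EuclideanSpace ℝ (Fin 3), p ∈ X ∧ ∃ (d η γ : ℝ) (A : EuclideanSpace ℝ (Fin 3) →ₗᵢ[ℝ] EuclideanSpace ℝ (Fin 3)), (∃ t : ↥Literature.Geometry.DiscreteGeometry.fccKissingPattern → EuclideanSpace ℝ (Fin 3), 0 < d ∧ 0 < γ ∧ η < 1 / 20 ∧ (∀ u : ↥Literature.Geometry.DiscreteGeometry.fccKissingPattern, t u ∈ X ∧ ‖(t u - p) - d • A (u : EuclideanSpace ℝ (Fin 3))‖ ≤ η * d) ∧ (∀ s : EuclideanSpace ℝ (Fin 3), s ∈ X → s ≠ p → d ≤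 dist s p) ∧ (∃ s : EuclideanSpace ℝ (Fin 3), s ∈ X ∧ s ≠ p ∧ dist s p ≤ d) ∧ (∀ s : EuclideanSpace ℝ (Fin 3), s ∈ X → s ≠ p → dist s p < 13 / 10 * d + γ → dist s p ≤ 13 / 10 * d - γ ∧ s ∈ Set.range t)) ∨ (∃ t : ↥Literature.Geometry.DiscreteGeometry.hcpKissingPattern → EuclideanSpace ℝ (Fin 3), 0 < d ∧ 0 < γ ∧ η < 1 / 20 ∧ (∀ u : ↥Literature.Geometry.DiscreteGeometry.hcpKissingPattern, t u ∈ X ∧ ‖(t u - p) - d • A (u : EuclideanSpace ℝ (Fin 3))‖ ≤ η * d) ∧ (∀ s : EuclideanSpace ℝ (Fin 3), s ∈ X → s ≠ p → d ≤ dist s p) ∧ (∃ s : EuclideanSpace ℝ (Fin 3), s ∈ X ∧ s ≠ p ∧ dist s p ≤ d) ∧ (∀ s : EuclideanSpace ℝ (Fin 3), s ∈ X → s ≠ p → dist s p < 13 / 10 * d + γ → dist s p ≤ 13 / 10 * d - γ ∧ s ∈ Set.range t))) :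
    Summit.AtomisticToContinuum.Crystallization.Theses.FrustratedLawDichotomy.AperiodicFrustratedLawGap :=
  aperiodicFrustratedLawGap_of_muEquilibriumDoor hDoor (rGSCaper_of_rGSC (rGSC_of_localCloseOrder hLCO))

/-- **`PeriodicFrustratedLawGap` (sibling crux, item 27624) BY NAME from `LCO`**, granted `MuEquilibriumDoor`. [folklore] -/
theorem periodicFrustratedLawGap_of_localCloseOrder
    (hDoor : Summit.AtomisticToContinuum.Crystallization.Theses.GrainCoreNetworkSplit.MuEquilibriumDoor)
    (hLCO : ∀ X : Set (EuclideanSpace ℝ (Fin 3)), (0 : EuclideanSpace ℝ (Fin 3)) ∈ X → (∀ a ∈ X, ∀ b ∈ X, a ≠ b → (7 : ℝ) / 10 ≤ dist a b) → Literature.MathematicalPhysics.StatisticalMechanics.IsMuGSC Literature.MathematicalPhysics.StatisticalMechanics.lennardJones (⨅ Q : Literature.MathematicalPhysics.StatisticalMechanics.PeriodicConfiguration 3, Q.energyPerParticle Literature.MathematicalPhysics.StatisticalMechanics.lennardJones) X → ∃ p : EuclideanSpace ℝ (Fin 3), p ∈ X ∧ ∃ (d η γ : ℝ) (A : EuclideanSpace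 ℝ (Fin 3) →ₗᵢ[ℝ] EuclideanSpace ℝ (Fin 3)), (∃ t : ↥Literature.Geometry.DiscreteGeometry.fccKissingPattern → EuclideanSpace ℝ (Fin 3), 0 < d ∧ 0 < γ ∧ η < 1 / 20 ∧ (∀ u : ↥Literature.Geometry.DiscreteGeometry.fccKissingPattern, t u ∈ X ∧ ‖(t u - p) - d • A (u : EuclideanSpace ℝ (Fin 3))‖ ≤ η * d) ∧ (∀ s : EuclideanSpace ℝ (Fin 3), s ∈ X → s ≠ p → d ≤ dist s p) ∧ (∃ s : EuclideanSpace ℝ (Fin 3), s ∈ X ∧ s ≠ p ∧ dist s p ≤ d) ∧ (∀ s : EuclideanSpace ℝ (Fin 3), s ∈ X → s ≠ p → dist s p < 13 / 10 * d + γ → dist s p ≤ 13 / 10 * d - γ ∧ s ∈ Set.range t)) ∨ (∃ t : ↥Literature.Geometry.DiscreteGeometry.hcpKissingPattern → EuclideanSpace ℝ (Fin 3), 0 < d ∧ 0 < γ ∧ η < 1 / 20 ∧ (∀ u : ↥Literature.Geometry.DiscreteGeometry.hcpKissingPattern, t u ∈ X ∧ ‖(t u - p) - d • A (u : EuclideanSpace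 ℝ (Fin 3))‖ ≤ η * d) ∧ (∀ s : EuclideanSpace ℝ (Fin 3), s ∈ X → s ≠ p → d ≤ dist s p) ∧ (∃ s : EuclideanSpace ℝ (Fin 3), s ∈ X ∧ s ≠ p ∧ dist s p ≤ d) ∧ (∀ s : EuclideanSpace ℝ (Fin 3), s ∈ X → s ≠ p → dist s p < 13 / 10 * d + γ → dist s p ≤ 13 / 10 * d - γ ∧ s ∈ Set.range t))) :
    Summit.AtomisticToContinuum.Crystallization.Theses.FrustratedLawDichotomy.PeriodicFrustratedLawGap :=
  periodicFrustratedLawGap_of_muEquilibriumDoor hDoor (rGSC_of_localCloseOrder hLCO)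

/-- **THE REGISTERED STUB `stub_aperiodicErgodicGap` (skeleton dd3251ad of item 27623, text VERBATIM) from `LCO`**, granted `MuEquilibriumDoor`.
[folklore] -/
theorem aperiodicErgodicGap_of_localCloseOrder
    (hDoor : Summit.AtomisticToContinuum.Crystallization.Theses.GrainCoreNetworkSplit.MuEquilibriumDoor)
    (hLCO : ∀ X : Set (EuclideanSpace ℝ (Fin 3)), (0 : EuclideanSpace ℝ (Fin 3)) ∈ X → (∀ a ∈ X, ∀ b ∈ X, a ≠ b → (7 : ℝ) / 10 ≤ dist a b) → Literature.MathematicalPhysics.StatisticalMechanics.IsMuGSC Literature.MathematicalPhysics.StatisticalMechanics.lennardJones (⨅ Q : Literature.MathematicalPhysics.StatisticalMechanics.PeriodicConfiguration 3, Q.energyPerParticle Literature.MathematicalPhysics.StatisticalMechanics.lennardJones) X → ∃ p : EuclideanSpace ℝ (Fin 3), p ∈ X ∧ ∃ (d η γ : ℝ) (A : EuclideanSpace ℝ (Fin 3) →ₗᵢ[ℝ] EuclideanSpace ℝ (Fin 3)), (∃ t : ↥Literature.Geometry.DiscreteGeometry.fccKissingPattern → EuclideanSpace ℝ (Fin 3),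 0 < d ∧ 0 < γ ∧ η < 1 / 20 ∧ (∀ u : ↥Literature.Geometry.DiscreteGeometry.fccKissingPattern, t u ∈ X ∧ ‖(t u - p) - d • A (u : EuclideanSpace ℝ (Fin 3))‖ ≤ η * d) ∧ (∀ s : EuclideanSpace ℝ (Fin 3), s ∈ X → s ≠ p → d ≤ dist s p) ∧ (∃ s : EuclideanSpace ℝ (Fin 3), s ∈ X ∧ s ≠ p ∧ dist s p ≤ d) ∧ (∀ s : EuclideanSpace ℝ (Fin 3), s ∈ X → s ≠ p → dist s p < 13 / 10 * d + γ → dist s p ≤ 13 / 10 * d - γ ∧ s ∈ Set.range t)) ∨ (∃ t : ↥Literature.Geometry.DiscreteGeometry.hcpKissingPattern → EuclideanSpace ℝ (Fin 3), 0 < d ∧ 0 < γ ∧ η < 1 / 20 ∧ (∀ u : ↥Literature.Geometry.DiscreteGeometry.hcpKissingPattern, t u ∈ X ∧ ‖(t u - p) - d • A (u : EuclideanSpace ℝ (Fin 3))‖ ≤ η * d) ∧ (∀ s : EuclideanSpace ℝ (Fin 3), s ∈ X → s ≠ p → d ≤ dist s p) ∧ (∃ s : EuclideanSpace ℝ (Fin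 3), s ∈ X ∧ s ≠ p ∧ dist s p ≤ d) ∧ (∀ s : EuclideanSpace ℝ (Fin 3), s ∈ X → s ≠ p → dist s p < 13 / 10 * d + γ → dist s p ≤ 13 / 10 * d - γ ∧ s ∈ Set.range t))) :
    ∀ δ : ℝ, 0 < δ → ∀ P : MeasureTheory.Measure (MeasureTheory.Measure (EuclideanSpace ℝ (Fin 3))), let Gy : ℝ → (N : ℕ) → (Fin N → EuclideanSpace ℝ (Fin 3)) → Fin N → Prop := fun η N y j => let d : ℝ := sInf ((fun z => dist z (y (j : Fin N))) '' (Set.range (y) \ {(y (j : Fin N))})); let T : Set (EuclideanSpace ℝ (Fin 3)) := {z : EuclideanSpace ℝ (Fin 3) | z ∈ Set.range (y) ∧ z ≠ (y (j : Fin N)) ∧ dist z (y (j : Fin N)) < 13 / 10 * d}; ∃ A : EuclideanSpace ℝ (Fin 3) →ₗᵢ[ℝ] EuclideanSpace ℝ (Fin 3), (∃ e : ↥T ≃ ↥Literature.Geometry.DiscreteGeometry.fccKissingPattern, ∀ t : ↥T, dist (d⁻¹ • ((t : EuclideanSpace ℝ (Fin 3)) - (y (j : Fin N)))) (A ((e t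 : ↥Literature.Geometry.DiscreteGeometry.fccKissingPattern) : EuclideanSpace ℝ (Fin 3))) ≤ η) ∨ (∃ e : ↥T ≃ ↥Literature.Geometry.DiscreteGeometry.hcpKissingPattern, ∀ t : ↥T, dist (d⁻¹ • ((t : EuclideanSpace ℝ (Fin 3)) - (y (j : Fin N)))) (A ((e t : ↥Literature.Geometry.DiscreteGeometry.hcpKissingPattern) : EuclideanSpace ℝ (Fin 3))) ≤ η); let TexBall : (N : ℕ) → (Fin N → EuclideanSpace ℝ (Fin 3)) → Fin N → ℝ → ℝ → ℝ → ℝ → Prop := fun N y i R R₇ R₈ R₉ => (∀ a b : Fin N, a ≠ b → (7 : ℝ) / 10 ≤ dist (y a) (y b)) ∧ (∀ j : Fin N, dist (y j) (y i) ≤ R → ¬ Gy (1 / 20) N (y) j) ∧ (∀ j : Fin N, dist (y j) (y i) ≤ R → ¬ ((∀ j' : Fin N, dist (y j') (y j) ≤ R₇ → ¬ Gy (1 / 20) N (y) j') ∧ (∀ z : EuclideanSpace ℝ (Fin 3), dist z (y j) ≤ R₇ → ∃ k : Fin N, dist z (y k) ≤ 1) ∧ (∀ j' : Fin N, dist (y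 j') (y j) ≤ R₇ → (let d : ℝ := sInf ((fun z => dist z (y j')) '' (Set.range (y) \ {(y j')})); ∀ k : Fin N, y k ≠ y j' → dist (y k) (y j') < 27 / 20 * d → 5 ≤ Nat.card {m : Fin N // y m ≠ y j' ∧ dist (y m) (y j') < 27 / 20 * d ∧ y m ≠ y k ∧ dist (y m) (y k) < 27 / 20 * d})))) ∧ (∀ j : Fin N, dist (y j) (y i) ≤ R → ∃ k : Fin N, dist (y k) (y j) ≤ R₈ ∧ Gy (1 / 8) N (y) k) ∧ (∀ j : Fin N, dist (y j) (y i) ≤ R → ¬ ((∀ j' : Fin N, dist (y j') (y j) ≤ R₉ → ¬ Gy (1 / 20) N (y) j') ∧ (Nat.card {j' : Fin N // dist (y j') (y j) ≤ R₉ ∧ ¬ Gy (1 / 8) N (y) j'} : ℝ) ≤ 1 / 2 * (Nat.card {j' : Fin N // dist (y j') (y j) ≤ R₉} : ℝ) ∧ (∀ j' : Fin N, dist (y j') (y j) ≤ R₉ → ¬ Gy (1 / 8) N (y) j' → ¬ (let d : ℝ := sInf ((fun z => dist z (y j')) '' (Set.range (y) \ {(y j')})); ∀ k : Fin N, y k ≠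 y j' → dist (y k) (y j') < 27 / 20 * d → 5 ≤ Nat.card {m : Fin N // y m ≠ y j' ∧ dist (y m) (y j') < 27 / 20 * d ∧ y m ≠ y k ∧ dist (y m) (y k) < 27 / 20 * d})))); let Appr : MeasureTheory.Measure (EuclideanSpace ℝ (Fin 3)) → ℝ → ℝ → ℝ → Prop := fun μ R₇ R₈ R₉ => ∀ q : EuclideanSpace ℝ (Fin 3), μ {q} ≠ 0 → ∀ R ε : ℝ, 0 < ε → ∃ (N : ℕ) (y : Fin N → EuclideanSpace ℝ (Fin 3)) (i : Fin N), TexBall N y i R R₇ R₈ R₉ ∧ (∀ p : EuclideanSpace ℝ (Fin 3), μ {p} ≠ 0 → dist p q ≤ R → ∃ k : Fin N, dist (y k - y i) (p - q) ≤ ε) ∧ (∀ k : Fin N, dist (y k) (y i) ≤ R → ∃ p : EuclideanSpace ℝ (Fin 3), μ {p} ≠ 0 ∧ dist (y k - y i) (p - q) ≤ ε); MeasureTheory.IsProbabilityMeasure P → (∀ᵐ μ ∂P, Literature.Probability.Process.IsRootedHardCore δ μ) → Literature.Probability.Process.IsPointStationaryLaw P → (∃ R₇ R₈ R₉ : ℝ,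 ∀ᵐ μ ∂P, Appr μ R₇ R₈ R₉) → (∀ᵐ μ ∂P, ∀ p : EuclideanSpace ℝ (Fin 3), μ {p} ≠ 0 → ∀ y : EuclideanSpace ℝ (Fin 3), (∀ q : EuclideanSpace ℝ (Fin 3), μ {q} ≠ 0 → q ≠ p → y ≠ q) → ∑' q : {q : EuclideanSpace ℝ (Fin 3) // μ {q} ≠ 0 ∧ q ≠ p}, Literature.MathematicalPhysics.StatisticalMechanics.lennardJones (dist p (q : EuclideanSpace ℝ (Fin 3))) ≤ ∑' q : {q : EuclideanSpace ℝ (Fin 3) // μ {q} ≠ 0 ∧ q ≠ p}, Literature.MathematicalPhysics.StatisticalMechanics.lennardJones (dist y (q : EuclideanSpace ℝ (Fin 3)))) → P {μ : MeasureTheory.Measure (EuclideanSpace ℝ (Fin 3)) | ∃ Q : Literature.MathematicalPhysics.StatisticalMechanics.PeriodicConfiguration 3, ∃ t : EuclideanSpace ℝ (Fin 3), {p : EuclideanSpace ℝ (Fin 3) | μ {p} ≠ 0} = (fun s => s + t) '' Q.points} = 0 → (∀ A : Set (MeasureTheory.Measure (EuclideanSpace ℝ (Fin 3))), MeasurableSet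 A → (∀ μ : MeasureTheory.Measure (EuclideanSpace ℝ (Fin 3)), ∀ p : EuclideanSpace ℝ (Fin 3), μ {p} ≠ 0 → (μ ∈ A ↔ MeasureTheory.Measure.map (fun z : EuclideanSpace ℝ (Fin 3) => z - p) μ ∈ A)) → P A = 0 ∨ P Aᶜ = 0) → (⨅ Q : Literature.MathematicalPhysics.StatisticalMechanics.PeriodicConfiguration 3, Q.energyPerParticle Literature.MathematicalPhysics.StatisticalMechanics.lennardJones) < (∫ μ, Literature.MathematicalPhysics.StatisticalMechanics.rootEnergy Literature.MathematicalPhysics.StatisticalMechanics.lennardJones μ ∂P) :=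
  aperiodicErgodicGap_of_muEquilibriumDoor hDoor (rGSCaper_of_rGSC (rGSC_of_localCloseOrder hLCO))

/-- **The `PeriodicChargeSplit` copy of the crux decl BY NAME from `LCO`**, granted `MuEquilibriumDoor`. [folklore] -/
theorem periodicChargeSplit_aperiodicFrustratedLawGap_of_localCloseOrder
    (hDoor : Summit.AtomisticToContinuum.Crystallization.Theses.GrainCoreNetworkSplit.MuEquilibriumDoor)
    (hLCO : ∀ X : Set (EuclideanSpace ℝ (Fin 3)), (0 : EuclideanSpace ℝ (Fin 3)) ∈ X → (∀ a ∈ X, ∀ b ∈ X, a ≠ b → (7 : ℝ) / 10 ≤ dist a b) → Literature.MathematicalPhysics.StatisticalMechanics.IsMuGSC Literature.MathematicalPhysics.StatisticalMechanics.lennardJones (⨅ Q : Literature.MathematicalPhysics.StatisticalMechanics.PeriodicConfiguration 3, Q.energyPerParticle Literature.MathematicalPhysics.StatisticalMechanics.lennardJones) X → ∃ p : EuclideanSpace ℝ (Fin 3), p ∈ X ∧ ∃ (d η γ : ℝ) (A : EuclideanSpace ℝ (Fin 3) →ₗᵢ[ℝ] EuclideanSpace ℝ (Fin 3)), (∃ t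 : ↥Literature.Geometry.DiscreteGeometry.fccKissingPattern → EuclideanSpace ℝ (Fin 3), 0 < d ∧ 0 < γ ∧ η < 1 / 20 ∧ (∀ u : ↥Literature.Geometry.DiscreteGeometry.fccKissingPattern, t u ∈ X ∧ ‖(t u - p) - d • A (u : EuclideanSpace ℝ (Fin 3))‖ ≤ η * d) ∧ (∀ s : EuclideanSpace ℝ (Fin 3), s ∈ X → s ≠ p → d ≤ dist s p) ∧ (∃ s : EuclideanSpace ℝ (Fin 3), s ∈ X ∧ s ≠ p ∧ dist s p ≤ d) ∧ (∀ s : EuclideanSpace ℝ (Fin 3), s ∈ X → s ≠ p → dist s p < 13 / 10 * d + γ → dist s p ≤ 13 / 10 * d - γ ∧ s ∈ Set.range t)) ∨ (∃ t : ↥Literature.Geometry.DiscreteGeometry.hcpKissingPattern → EuclideanSpace ℝ (Fin 3), 0 < d ∧ 0 < γ ∧ η < 1 / 20 ∧ (∀ u : ↥Literature.Geometry.DiscreteGeometry.hcpKissingPattern, t u ∈ X ∧ ‖(t u - p) - d • A (u : EuclideanSpace ℝ (Fin 3))‖ ≤ η * d) ∧ (∀ s : EuclideanSpace ℝ (Fin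 3), s ∈ X → s ≠ p → d ≤ dist s p) ∧ (∃ s : EuclideanSpace ℝ (Fin 3), s ∈ X ∧ s ≠ p ∧ dist s p ≤ d) ∧ (∀ s : EuclideanSpace ℝ (Fin 3), s ∈ X → s ≠ p → dist s p < 13 / 10 * d + γ → dist s p ≤ 13 / 10 * d - γ ∧ s ∈ Set.range t))) :
    Summit.AtomisticToContinuum.Crystallization.Theses.PeriodicChargeSplit.AperiodicFrustratedLawGap :=
  periodicChargeSplit_aperiodicFrustratedLawGap_of_muEquilibriumDoor hDoor (rGSCaper_of_rGSC (rGSC_of_localCloseOrder hLCO))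

end Summit.AtomisticToContinuum.Crystallization.Theorems.FrustratedLawDichotomyLocalCloseOrder

end
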